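import Summits.BirchSwinnertonDyer.Rank1Residual.P2.Conjectures.CongruentNumberEvenMonskyLawAtTwo
import Summits.BirchSwinnertonDyer.Rank1Residual.P2.CongruentNumberPairsAtTwoEvenRungTwo
import Summits.BirchSwinnertonDyer.Rank1Residual.P2.CongruentNumberPairsAtTwoEvenAtlasThree
import HarnessLib

/-!
# Sub-lane «bsd-p2»: the typed even Monsky law BELOW THE BLIND LINE is EXACTLY the two registered
# clause-sentences — `k = 2` ⟺ C-P2-1, `k = 3` ⟺ the thirteen-key sentence (bookkeeping between
# `Prop`s; nothing asserted, 0 facts discharged, 0 (K), nothing booked)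

A small file next to the typed law `P2/Conjectures/CongruentNumberEvenMonskyLawAtTwo.lean` (p2-lead GEN 9
TYPING WORD, bytes @3d15327a096ceaf0, LANDED p363094), composing three LANDED theorems: `congruentEvenBSDTwoAt_two_iff`
/ `congruentSilentEvenFiveBSDTwo_of_congruentEvenBSDTwoAt_two'` (`P2/CongruentNumberPairsAtTwoEvenRungTwo`, p373110,
W0 bytes @fde573f00e7fcf24 — typer GEN 21's draft, whose scratch @5cec224e named them
`rung_two_iff_congruentSilentEvenFiveBSDTwo` / `congruentSilentEvenFiveBSDTwo_of_rung_two`) and GEN 23's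
`evenRung_three_iff_keys` / `congruentSilentEvenThree_iff_keys` (`P2/…EvenAtlasThree`, bytes @80265c5d, WAKE-T-167
ORDER 3 (iii) D4). Typer GEN 23 scratch @7ff2a8027ac40011 (T-164 rails), RE-KEYED to the two landed W0 names by
p2-typer GEN 66 (`p2/typer/cn/rekey_d6_evenrungtwo_w0.py`; statements and theorem names of this file unchanged).

HONEST FRAMING (sub-lane «bsd-p2», run/shared/lean/b2b/bsd-rank1-residual/p2/, verbatim in every
file): the target of record is the FULL Birch–Swinnerton-Dyer formula for EVERY analytic-rank `≤ 1`
`E/ℚ` at ALL primes INCLUDING `2`; the odd-prime class ledger is referee A's; the `2`-part is OPEN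
(cells O1 = X5 ∖ CM and O12 = the CM corner) and under census by «bsd-p2». Census / instrument
output at `2` = EVIDENCE / conjecture items with held-out validation, NEVER a Literature fact;
certificates close PAIRS (one isogeny class, `p = 2`), never classes. A conjecture `Prop` is a
SENTENCE. This file asserts NO arithmetic fact: kernel implications / equivalences between `Prop`s,
under the displayed named facts `hTYZ` (`tyz_genusPointData`), `hGZK`, `hMe`, `hR` where stated — and
with NO fact at all for the direction «law ⟹ registered clauses».

WHAT IT SAYS. With the RULED quantifier (U) `2 ≤ k`, the rungs of `CongruentEvenMonskyBSDTwo` below the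
first blind rung `k = 4` are: `CongruentEvenBSDTwoAt 2 ⟺ CongruentSilentEvenFiveBSDTwo` (C-P2-1, p344657;
PT15 / PR-P2-1·3·4) and `CongruentEvenBSDTwoAt 3 ⟺` «`r_an = 1 ∧ BSD₂` on the thirteen registered silent
keys» (PT16A / PT16B), each modulo {`hTYZ`, `hGZK`, `hMe`, `hR`} for «⟸» (the loud cells are DOOR B6
theorems) and modulo NOTHING for «⟹»; hence `(∀ k, 2 ≤ k → k ≤ 3 → CongruentEvenBSDTwoAt k) ⟺ (C-P2-1 ∧
key sentence)` and, fact-free, `CongruentEvenMonskyBSDTwo → C-P2-1 ∧ key sentence`: everything the typed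
law says below `k = 4` is the two scored clause sets, kernel-exactly; its NEW content starts at PT17A's rung.
Unit `b2b-bsdres-p2-typer` GEN 23; scratch.

References: [Monsky1990MockHeegner] Remark (3) (p. 67); [TianYuanZhang2017] Thm 1.2, Thm 3.5, §1 (1.1);
[HeathBrown1994SelmerCongruentII] Appendix (Monsky), typescript p. 41 L20–L36; [LiMa2008] Thm 0.4;
[Miller2011LMS] Def 1.1; HOME `p2/STRUCTURE-p2.md` v0.18 §3 / §7; `p2/LEAD-OKS.md` BATCH 70 / 74.
-/

noncomputable section

open scoped Classical

open WeierstrassCurve Literature.NumberTheory.EllipticCurves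
  Literature.NumberTheory.EllipticCurves.Rank1Residual
  Literature.NumberTheory.EllipticCurves.Rank1Residual.Typed
  Literature.NumberTheory.EllipticCurves.HeathBrown1994
  Literature.NumberTheory.EllipticCurves.TianYuanZhang2017
  Literature.NumberTheory.QuadraticFields.RedeiReichardt

set_option autoImplicit false

namespace Summit.BirchSwinnertonDyer.Rank1Residual.P2.Conjectures

/-- **Rung `k = 2` of the typed law IS C-P2-1** (mod `hTYZ`, `hGZK`, `hMe`, `hR`; U⁺ discharged by
`uPlus_of_genusPointData`): `CongruentEvenBSDTwoAt 2 ↔ CongruentSilentEvenFiveBSDTwo`.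
[cite: Monsky1990MockHeegner, Remark (3) (p. 67)] [cite: TianYuanZhang2017, Thm. 1.2, Thm. 3.5 and §1 (1.1)] -/
theorem congruentEvenBSDTwoAt_two_iff_congruentSilentEvenFiveBSDTwo (hTYZ : tyz_genusPointData)
    (hGZK : rank_eq_analyticRank_of_analyticRank_le_one) (hMe : monsky_card_selmerGroup_two_even)
    (hR : redeiReichardt_fourTwoCard_classGroup) :
    CongruentEvenBSDTwoAt 2 ↔ CongruentSilentEvenFiveBSDTwo :=
  congruentEvenBSDTwoAt_two_iff (uPlus_of_genusPointData hTYZ hGZK) hGZK hMe hR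

/-- **Rung `k = 3` of the typed law IS the thirteen-key sentence** (mod `hTYZ`, `hGZK`, `hMe`, `hR`).
[cite: Monsky1990MockHeegner, Remark (3) (p. 67)] [cite: TianYuanZhang2017, Thm. 1.2, Thm. 3.5 and §1 (1.1)] -/
theorem congruentEvenBSDTwoAt_three_iff_keys (hTYZ : tyz_genusPointData)
    (hGZK : rank_eq_analyticRank_of_analyticRank_le_one) (hMe : monsky_card_selmerGroup_two_even)
    (hR : redeiReichardt_fourTwoCard_classGroup) :
    CongruentEvenBSDTwoAt 3 ↔
      (∀ p : Fin 3 → ℕ, (∀ i, (p i).Prime) → Function.Injective p → (2 * ∏ i, p i) % 8 = 6 →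
        silentEvenCfg (fun i => p i % 8) (fun a b => kroneckerBit (p b) (p a)) = true →
          (congruentNumberCurve (2 * ∏ i, p i)).analyticRank = 1 ∧
            BSDp (congruentNumberCurve (2 * ∏ i, p i)) 2) :=
  evenRung_three_iff_keys hTYZ hGZK hMe hR

/-- **The RULE at `k = 3` in key currency** (mod `hR`): `CongruentSilentEvenBSDTwoAt 3` (the `Σ₂′`-even
restriction) ↔ the thirteen-key sentence. [cite: TianYuanZhang2017, Thm. 1.2 (n ≡ 6 (mod 8))] [cite: LiMa2008, Thm. 0.4] -/
theorem congruentSilentEvenBSDTwoAt_three_iff_keys (hR : redeiReichardt_fourTwoCard_classGroup) :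
    CongruentSilentEvenBSDTwoAt 3 ↔
      (∀ p : Fin 3 → ℕ, (∀ i, (p i).Prime) → Function.Injective p → (2 * ∏ i, p i) % 8 = 6 →
        silentEvenCfg (fun i => p i % 8) (fun a b => kroneckerBit (p b) (p a)) = true →
          (congruentNumberCurve (2 * ∏ i, p i)).analyticRank = 1 ∧
            BSDp (congruentNumberCurve (2 * ∏ i, p i)) 2) :=
  congruentSilentEvenThree_iff_keys hR

/-- **BELOW THE BLIND LINE THE LAW IS THE TWO REGISTERED CLAUSE SETS** (mod `hTYZ`, `hGZK`, `hMe`, `hR`):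
`(∀ k, 2 ≤ k → k ≤ 3 → CongruentEvenBSDTwoAt k) ↔ (C-P2-1 ∧ thirteen-key sentence)`.
[cite: Monsky1990MockHeegner, Remark (3) (p. 67)] [cite: TianYuanZhang2017, Thm. 1.2, Thm. 3.5 and §1 (1.1)] -/
theorem congruentEvenBSDTwoAt_le_three_iff (hTYZ : tyz_genusPointData)
    (hGZK : rank_eq_analyticRank_of_analyticRank_le_one) (hMe : monsky_card_selmerGroup_two_even)
    (hR : redeiReichardt_fourTwoCard_classGroup) :
    (∀ k : ℕ, 2 ≤ k → k ≤ 3 → CongruentEvenBSDTwoAt k) ↔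
      (CongruentSilentEvenFiveBSDTwo ∧
        ∀ p : Fin 3 → ℕ, (∀ i, (p i).Prime) → Function.Injective p → (2 * ∏ i, p i) % 8 = 6 →
          silentEvenCfg (fun i => p i % 8) (fun a b => kroneckerBit (p b) (p a)) = true →
            (congruentNumberCurve (2 * ∏ i, p i)).analyticRank = 1 ∧
              BSDp (congruentNumberCurve (2 * ∏ i, p i)) 2) := by
  constructor
  · intro h
    exact ⟨(congruentEvenBSDTwoAt_two_iff_congruentSilentEvenFiveBSDTwo hTYZ hGZK hMe hR).mp
        (h 2 le_rfl (by norm_num)),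
      (congruentEvenBSDTwoAt_three_iff_keys hTYZ hGZK hMe hR).mp (h 3 (by norm_num) le_rfl)⟩
  · rintro ⟨h2, h3⟩ k hk hk3
    interval_cases k
    · exact (congruentEvenBSDTwoAt_two_iff_congruentSilentEvenFiveBSDTwo hTYZ hGZK hMe hR).mpr h2
    · exact (congruentEvenBSDTwoAt_three_iff_keys hTYZ hGZK hMe hR).mpr h3

/-- **FACT-FREE: the tagged law implies BOTH registered clause-sentences** — `CongruentEvenMonskyBSDTwo`
(quantifier (U) `2 ≤ k`) gives C-P2-1 (rung `2`, `congruentSilentEvenFiveBSDTwo_of_congruentEvenBSDTwoAt_two'` of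
`…EvenRungTwo` p373110, no fact) and the thirteen-key sentence (rung `3`, `keys_of_evenRung_three`, no fact). Neither side is
asserted. [cite: Monsky1990MockHeegner, Remark (3) (p. 67)] -/
theorem registeredClauses_of_congruentEvenMonskyBSDTwo (h : CongruentEvenMonskyBSDTwo) :
    CongruentSilentEvenFiveBSDTwo ∧
      ∀ p : Fin 3 → ℕ, (∀ i, (p i).Prime) → Function.Injective p → (2 * ∏ i, p i) % 8 = 6 →
        silentEvenCfg (fun i => p i % 8) (fun a b => kroneckerBit (p b) (p a)) = true →
          (congruentNumberCurve (2 * ∏ i, p i)).analyticRank = 1 ∧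
            BSDp (congruentNumberCurve (2 * ∏ i, p i)) 2 :=
  ⟨congruentSilentEvenFiveBSDTwo_of_congruentEvenBSDTwoAt_two' (h 2 le_rfl),
    keys_of_evenRung_three (h 3 (by norm_num))⟩

end Summit.BirchSwinnertonDyer.Rank1Residual.P2.Conjectures

end
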